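import Summits.CriticalPhenomena.CardyFormulaZ2.Theorems.CardyBondTriangularBondTriangularCardyKiteBDarts
import Literature.Probability.Percolation.SiteInterfaceStructure
import HarnessLib

/-!
# Route CardyBondTriangular · crux `BondTriangularCardy` · line `birth`: one step of the kite interface

Helper of the stub `stub_blueArm`. For the kite darts of `…KiteBDarts` with the kite colouring
`kcol G σ` of a 3-marked domain: the geometry of the darts produced by the successor `succ`
(cells and corners), **the successor of an interface dart is an interface dart**
(`iface_succ`; at a centre this is the half-hexagon structure of the Chayes–Lei states, opposite
kites of a split hexagon having opposite colours), admissibility is kept, and the cells on the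
two sides move along chains: the new left cell is the old one or a neighbour blue at a common
corner (`leftCell_succ`), the new right cell is the old one or a neighbour yellow at a common
corner (`rightCell_succ`, by the exclusion of the alternating pattern around an edge midpoint,
`noAlt`, i.e. Chayes–Lei's "only three of the six splits occur").

## References

* B. Bollobás, O. Riordan, *Percolation*, CUP (2006), Ch. 7, Lemma 5 p. 170, Claim 10 p. 178.
* L. Chayes, H. K. Lei, Rev. Math. Phys. 19 (2007), §2.1.
-/

namespace Summit.CriticalPhenomena.CardyFormulaZ2.Theorems.BondTriangularCardyLine.KiteB

open Literature.Probability.Percolation Literature.Probability.LatticeModels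
open RemovableAt (hexFaceVertices_leftFaceDir leftFaceDir_injective)
open TriMarkedDomain (fin3_add_one_add_one fin3_add_two_add_one fin3_add_two_add_two fin3_add_one_add_two)

/-! ### Geometry of the darts -/

/-- The face left of the side from the `(j+1)`-st to the `(j+2)`-nd vertex is the face itself. -/
theorem leftFace_succ_succ (F : HexVertex) (j : Fin 3) :
    leftFace (faceVertex F (j + 1)) (faceVertex F (j + 2)) = F := by
  rw [← fin3_add_one_add_one]; exact leftFace_faceVertex F (j + 1)

/-- The index of a vertex given by an equation. -/
theorem kidx_of_eq {F : HexVertex} {x : Site 2} {i : Fin 3} (h : faceVertex F i = x) : kidx F x = i := by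
  subst h; exact kidx_faceVertex F i

/-- **The left face of an adjacent pair**: the pair is its anticlockwise side starting at the index
of the first site. -/
theorem faceVertex_kidx_leftFace {x y : Site 2} (h : triGraph.Adj x y) :
    faceVertex (leftFace x y) (kidx (leftFace x y) x) = x ∧ faceVertex (leftFace x y) (kidx (leftFace x y) x + 1) = y := by
  obtain ⟨i, hx, hy⟩ := exists_eq_faceVertex_of_adj h
  rw [kidx_of_eq hx.symm]; exact ⟨hx.symm, hy.symm⟩

/-- The face across the side of an adjacent pair in its left face is the left face of the
reversed pair. -/
theorem oppFace_leftFace {x y : Site 2} (h : triGraph.Adj x y) :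
    oppFace (leftFace x y) (kidx (leftFace x y) x + 2) = leftFace y x := by
  obtain ⟨hx, hy⟩ := faceVertex_kidx_leftFace h
  set A := leftFace x y
  set i := kidx A x
  have := leftFace_faceVertex_rev A (i + 2)
  rw [fin3_add_two_add_two, fin3_add_two_add_one, hx, hy] at this
  exact this.symm

/-- The opposite neighbour: `x + (x - (x + v)) = x - v`, by directions. -/
theorem opp_eq (x : Site 2) (k : Fin 6) : x + (x - (x + triDir k)) = x + triDir (k + 3) := by
  rw [triDir_add_three]; abel

/-- The opposite neighbour is adjacent. -/
theorem adj_opp {x y : Site 2} (h : triGraph.Adj x y) : triGraph.Adj x (x + (x - y)) := by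
  obtain ⟨k, rfl⟩ := (triGraph_adj_iff_triDir x y).1 h
  rw [opp_eq]; exact triGraph_adj_add_triDir _ _

/-! ### The successor keeps admissibility -/

section Step

variable {D : TriMarkedDomain 3} {σ : CLHexConfig}

/-- **The successor of an admissible dart is admissible.** -/
theorem adm_succ (κ : HexVertex → Fin 3 → Bool) {d : KDart} (hd : d.adm = true) : (succ κ d).adm = true := by
  cases d with
  | toMid F j =>
    simp only [succ]
    split_ifs
    · exact (KDart.adm_toCtr _ _).2 (adj_exitDart F j)
    · rfl
    · exact (KDart.adm_toCtr _ _).2 (adj_exitDart F j).symm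
  | fromMid F j => simp only [succ]; split_ifs <;> rfl
  | toCtr x y => exact (KDart.adm_fromCtr _ _).2 (adj_opp ((KDart.adm_toCtr x y).1 hd))
  | fromCtr x y =>
    have h := (KDart.adm_fromCtr x y).1 hd
    simp only [succ]
    split_ifs
    · rfl
    · exact (KDart.adm_toCtr _ _).2 h.symm
    · rfl

/-! ### No alternating pattern around an edge midpoint -/

/-- **Chayes–Lei's local rule at an edge midpoint**: for adjacent hexagons `p, q` (one of them in
`G`) with common corners `G₁ ≠ G₂`, if the kite of `p` is blue at `G₁` and yellow at `G₂` and the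
kite of `q` is yellow at `G₁`, then the kite of `q` is yellow at `G₂` too — the four kites around
the midpoint never alternate (a hexagon of `G` yellow at an up-corner is yellow at the adjacent
down-corners; an outer hexagon shows one colour along the edge). -/
theorem noAlt {p q : Site 2} (hpq : triGraph.Adj p q) (hin : p ∈ D.verts ∨ q ∈ D.verts) {G₁ G₂ : HexVertex}
    (hne : G₁ ≠ G₂) (hp1 : p ∈ hexFaceVertices G₁) (hq1 : q ∈ hexFaceVertices G₁)
    (hp2 : p ∈ hexFaceVertices G₂) (hq2 : q ∈ hexFaceVertices G₂)
    (c1 : ccol D σ p G₁ = false) (c2 : ccol D σ p G₂ = true) (c3 : ccol D σ q G₁ = true) :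
    ccol D σ q G₂ = true := by
  obtain ⟨k, k', hkk', hu, hdn, hF⟩ := common_corners hpq
  -- `p` is in `G` (an outer hexagon shows one colour along the edge towards `q ∈ G`)
  have hp : p ∈ D.verts := by
    by_contra hp
    have hq : q ∈ D.verts := hin.resolve_left hp
    rw [ccol_of_not_mem hp hq hp1 hq1] at c1
    rw [ccol_of_not_mem hp hq hp2 hq2] at c2
    rw [c1] at c2; exact absurd c2 (by decide)
  have h1 := (hF G₁).1 ⟨hp1, hq1⟩
  have h2 := (hF G₂).1 ⟨hp2, hq2⟩
  rw [ccol_of_mem hp hp1] at c1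
  rw [ccol_of_mem hp hp2] at c2
  simp only [decide_eq_false_iff_not, decide_eq_true_eq] at c1 c2
  -- `G₁` is the up-corner, `G₂` the down-corner
  have hG : G₁ = upCorner p k ∧ G₂ = downCorner p k' := by
    rcases h1 with rfl | rfl <;> rcases h2 with rfl | rfl
    · exact absurd rfl hne
    · exact ⟨rfl, rfl⟩
    · exact absurd (CLHexState.yellowAt_downCorner_of_upCorner c2 hkk'.symm) c1
    · exact absurd rfl hne
  obtain ⟨rfl, rfl⟩ := hG
  by_cases hq : q ∈ D.verts
  · rw [ccol_of_mem hq hq1, hu] at c3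
    rw [ccol_of_mem hq hq2, hdn, decide_eq_true_iff]
    simp only [decide_eq_true_eq] at c3
    exact CLHexState.yellowAt_downCorner_of_upCorner c3 hkk'
  · rw [ccol_of_not_mem hq hp hq1 hp1] at c3
    rw [ccol_of_not_mem hq hp hq2 hp2]; exact c3

/-- **The two faces of an adjacent pair are distinct** (registered anchor of this file). -/
theorem leftFace_ne_leftFace_rev : ∀ {x y : Literature.Probability.LatticeModels.Site 2}, Literature.Probability.LatticeModels.triGraph.Adj x y → Literature.Probability.Percolation.leftFace x y ≠ Literature.Probability.Percolation.leftFace y x := by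
  intro x y h
  obtain ⟨k, rfl⟩ := (triGraph_adj_iff_triDir x y).1 h
  rw [leftFace_add_triDir, leftFace_add_triDir_rev]
  intro e
  exact absurd (left_eq_add.1 (leftFaceDir_injective x e)) (by decide)

/-- Membership of the two sites in the two faces of an adjacent pair. -/
theorem mem_leftFace_four {x y : Site 2} (h : triGraph.Adj x y) :
    x ∈ hexFaceVertices (leftFace x y) ∧ y ∈ hexFaceVertices (leftFace x y) ∧
      x ∈ hexFaceVertices (leftFace y x) ∧ y ∈ hexFaceVertices (leftFace y x) := by
  rw [hexFaceVertices_leftFace h, hexFaceVertices_leftFace h.symm]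
  simp

/-! ### The successor of an interface dart is an interface dart -/

/-- The abstract kite colour read from `kcol` is `ccol`. -/
@[simp] theorem kc_kcol (x : Site 2) (F : HexVertex) : kc (kcol D σ) x F = ccol D σ x F := rfl

/-- The kite of the left cell of `toMid F j`, seen in the face across. -/
theorem kcol_oppIdx_succ (F : HexVertex) (j : Fin 3) :
    kcol D σ (oppFace F j) (oppIdx F j + 1) = ccol D σ (faceVertex F (j + 2)) (oppFace F j) := by
  rw [← faceVertex_oppFace_succ, ccol_faceVertex]

/-- The kite of the right cell of `toMid F j`, seen in the face across. -/
theorem kcol_oppIdx_succ_succ (F : HexVertex) (j : Fin 3) :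
    kcol D σ (oppFace F j) (oppIdx F j + 2) = ccol D σ (faceVertex F (j + 1)) (oppFace F j) := by
  rw [← faceVertex_oppFace_succ_succ, ccol_faceVertex]

/-- The cells, corners and the interface condition of the darts, unfolded (`simp` set). -/
theorem iface_iff' (d : KDart) : iface (kcol D σ) d = true ↔
    ccol D σ d.leftCell d.leftCorner = false ∧ ccol D σ d.rightCell d.rightCorner = true := iface_iff _ d

/-- **The successor of an interface dart is an interface dart** (for an admissible dart whose left
cell is in `G`; the latter is needed only along a split line, inside the left cell). -/
theorem iface_succ {d : KDart} (hd : iface (kcol D σ) d = true) (hadm : d.adm = true) (hG : d.leftCell ∈ D.verts) :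
    iface (kcol D σ) (succ (kcol D σ) d) = true := by
  rw [iface_iff'] at hd ⊢
  obtain ⟨hl, hr⟩ := hd
  cases d with
  | toMid F j =>
    simp only [KDart.leftCell, KDart.rightCell, KDart.leftCorner, KDart.rightCorner, ccol_faceVertex] at hl hr
    have e1 := faceVertex_oppFace_succ F j
    have e2 := faceVertex_oppFace_succ_succ F j
    simp only [succ]
    split_ifs with h1 h2
    · simp only [KDart.leftCell, KDart.rightCell, KDart.leftCorner, KDart.rightCorner, leftFace_succ_succ,
        leftFace_faceVertex_rev, ccol_faceVertex]
      refine ⟨hl, ?_⟩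
      rw [← e1, ccol_faceVertex]; exact h1
    · simp only [KDart.leftCell, KDart.rightCell, KDart.leftCorner, KDart.rightCorner, ccol_faceVertex]
      exact ⟨by simpa using h1, h2⟩
    · simp only [KDart.leftCell, KDart.rightCell, KDart.leftCorner, KDart.rightCorner, leftFace_succ_succ,
        leftFace_faceVertex_rev, ccol_faceVertex]
      refine ⟨?_, hr⟩
      rw [← e2, ccol_faceVertex]; simpa using h2
  | fromMid F j =>
    simp only [KDart.leftCell, KDart.rightCell, KDart.leftCorner, KDart.rightCorner, ccol_faceVertex] at hl hr
    simp only [succ]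
    split_ifs with h1
    · simp only [KDart.leftCell, KDart.rightCell, KDart.leftCorner, KDart.rightCorner, ccol_faceVertex,
        fin3_add_two_add_two, fin3_add_two_add_one]
      exact ⟨hl, h1⟩
    · simp only [KDart.leftCell, KDart.rightCell, KDart.leftCorner, KDart.rightCorner, ccol_faceVertex,
        fin3_add_one_add_two, fin3_add_one_add_one]
      exact ⟨by simpa using h1, hr⟩
  | toCtr x y =>
    simp only [KDart.leftCell, KDart.rightCell, KDart.leftCorner, KDart.rightCorner] at hl hr hG
    obtain ⟨k, rfl⟩ := (triGraph_adj_iff_triDir x y).1 ((KDart.adm_toCtr x y).1 hadm)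
    rw [leftFace_add_triDir_rev, ccol_leftFaceDir hG] at hl
    rw [leftFace_add_triDir, ccol_leftFaceDir hG] at hr
    obtain ⟨h3, -, -, h2⟩ := ytab_halves (σ x) k hl hr
    simp only [succ, KDart.leftCell, KDart.rightCell, KDart.leftCorner, KDart.rightCorner, opp_eq, leftFace_add_triDir,
      leftFace_add_triDir_rev, ccol_leftFaceDir hG]
    rw [show k + 3 + 5 = k + 2 by rw [add_assoc]; rfl]
    exact ⟨h3, h2⟩
  | fromCtr x y =>
    simp only [KDart.leftCell, KDart.rightCell, KDart.leftCorner, KDart.rightCorner] at hl hr hG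
    have h := (KDart.adm_fromCtr x y).1 hadm
    obtain ⟨hx, hy⟩ := faceVertex_kidx_leftFace h
    obtain ⟨hy', hx'⟩ := faceVertex_kidx_leftFace h.symm
    simp only [succ, kc_kcol]
    split_ifs with h1 h2
    · simp only [KDart.leftCell, KDart.rightCell, KDart.leftCorner, KDart.rightCorner, fin3_add_two_add_one,
        fin3_add_two_add_two, hx, hy]
      exact ⟨hl, h1⟩
    · simp only [KDart.leftCell, KDart.rightCell, KDart.leftCorner, KDart.rightCorner]
      exact ⟨by simpa using h1, h2⟩
    · simp only [KDart.leftCell, KDart.rightCell, KDart.leftCorner, KDart.rightCorner, fin3_add_two_add_one,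
        fin3_add_two_add_two, hy', hx']
      exact ⟨by simpa using h2, hr⟩


/-! ### The cells along a step -/

/-- **The left cells form a blue chain**: after a step the left cell is unchanged, or it is a
neighbour of the old one and both kites are blue at a common corner. -/
theorem leftCell_succ {d : KDart} (hd : iface (kcol D σ) d = true) (hadm : d.adm = true) :
    (succ (kcol D σ) d).leftCell = d.leftCell ∨
      (triGraph.Adj d.leftCell (succ (kcol D σ) d).leftCell ∧ ∃ G : HexVertex,
        d.leftCell ∈ hexFaceVertices G ∧ (succ (kcol D σ) d).leftCell ∈ hexFaceVertices G ∧
        ccol D σ d.leftCell G = false ∧ ccol D σ (succ (kcol D σ) d).leftCell G = false) := by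
  rw [iface_iff'] at hd
  obtain ⟨hl, hr⟩ := hd
  cases d with
  | toMid F j =>
    simp only [KDart.leftCell, KDart.rightCell, KDart.leftCorner, KDart.rightCorner, ccol_faceVertex] at hl hr
    have e1 := faceVertex_oppFace_succ F j
    have e2 := faceVertex_oppFace_succ_succ F j
    simp only [succ]
    split_ifs with h1 h2
    · exact Or.inl rfl
    · exact Or.inl e1
    · right
      simp only [KDart.leftCell]
      refine ⟨adj_exitDart F j, oppFace F j, e1 ▸ faceVertex_mem _ _, e2 ▸ faceVertex_mem _ _, ?_, ?_⟩
      · rw [← e1, ccol_faceVertex]; simpa using h1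
      · rw [← e2, ccol_faceVertex]; simpa using h2
  | fromMid F j =>
    simp only [KDart.leftCell, KDart.rightCell, KDart.leftCorner, KDart.rightCorner, ccol_faceVertex] at hl hr
    simp only [succ]
    split_ifs with h1
    · left; simp only [KDart.leftCell, fin3_add_two_add_two]
    · right
      simp only [KDart.leftCell, fin3_add_one_add_two]
      refine ⟨(TriMarkedDomain.adj_faceVertex_succ F j).symm, F, faceVertex_mem _ _, faceVertex_mem _ _, ?_, ?_⟩
      · rw [ccol_faceVertex]; exact hl
      · rw [ccol_faceVertex]; simpa using h1
  | toCtr x y => exact Or.inl rfl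
  | fromCtr x y =>
    simp only [KDart.leftCell, KDart.rightCell, KDart.leftCorner, KDart.rightCorner] at hl hr
    have h := (KDart.adm_fromCtr x y).1 hadm
    obtain ⟨hx, hy⟩ := faceVertex_kidx_leftFace h
    obtain ⟨hy', hx'⟩ := faceVertex_kidx_leftFace h.symm
    obtain ⟨m1, m2, -, -⟩ := mem_leftFace_four h
    simp only [succ, kc_kcol]
    split_ifs with h1 h2
    · left; simp only [KDart.leftCell, fin3_add_two_add_one, hx]
    · right
      simp only [KDart.leftCell]
      exact ⟨h, leftFace x y, m1, m2, hl, by simpa using h1⟩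
    · right
      simp only [KDart.leftCell, fin3_add_two_add_one, hy']
      exact ⟨h, leftFace x y, m1, m2, hl, by simpa using h1⟩

/-- **The right cells form a yellow chain**: after a step the right cell is unchanged, or it is a
neighbour of the old one and both kites are yellow at a common corner (for a dart whose left cell
is in `G`: the no-alternation rule is used when the walk turns into a hexagon). -/
theorem rightCell_succ {d : KDart} (hd : iface (kcol D σ) d = true) (hadm : d.adm = true) (hG : d.leftCell ∈ D.verts) :
    (succ (kcol D σ) d).rightCell = d.rightCell ∨
      (triGraph.Adj d.rightCell (succ (kcol D σ) d).rightCell ∧ ∃ G : HexVertex,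
        d.rightCell ∈ hexFaceVertices G ∧ (succ (kcol D σ) d).rightCell ∈ hexFaceVertices G ∧
        ccol D σ d.rightCell G = true ∧ ccol D σ (succ (kcol D σ) d).rightCell G = true) := by
  rw [iface_iff'] at hd
  obtain ⟨hl, hr⟩ := hd
  cases d with
  | toMid F j =>
    simp only [KDart.leftCell, KDart.rightCell, KDart.leftCorner, KDart.rightCorner, ccol_faceVertex] at hl hr hG
    have e1 := faceVertex_oppFace_succ F j
    have e2 := faceVertex_oppFace_succ_succ F j
    have hne : F ≠ oppFace F j := (hexGraph_adj_oppFace F j).ne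
    simp only [succ]
    split_ifs with h1 h2
    · right
      simp only [KDart.rightCell]
      have m1 : faceVertex F (j + 2) ∈ hexFaceVertices (oppFace F j) := e1 ▸ faceVertex_mem _ _
      have m2 : faceVertex F (j + 1) ∈ hexFaceVertices (oppFace F j) := e2 ▸ faceVertex_mem _ _
      have c1 : ccol D σ (faceVertex F (j + 2)) (oppFace F j) = true := by rw [← e1, ccol_faceVertex]; exact h1
      refine ⟨(adj_exitDart F j).symm, oppFace F j, m2, m1, ?_, c1⟩
      exact noAlt (adj_exitDart F j) (Or.inl hG) hne (faceVertex_mem _ _) (faceVertex_mem _ _) m1 m2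
        (by rw [ccol_faceVertex]; exact hl) c1 (by rw [ccol_faceVertex]; exact hr)
    · exact Or.inl e2
    · exact Or.inl rfl
  | fromMid F j =>
    simp only [KDart.leftCell, KDart.rightCell, KDart.leftCorner, KDart.rightCorner, ccol_faceVertex] at hl hr
    simp only [succ]
    split_ifs with h1
    · right
      simp only [KDart.rightCell, fin3_add_two_add_one]
      have hadj := TriMarkedDomain.adj_faceVertex_succ F (j + 2)
      rw [fin3_add_two_add_one] at hadj
      refine ⟨hadj, F, faceVertex_mem _ _, faceVertex_mem _ _, ?_, ?_⟩
      · rw [ccol_faceVertex]; exact hr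
      · rw [ccol_faceVertex]; exact h1
    · left; simp only [KDart.rightCell, fin3_add_one_add_one]
  | toCtr x y => exact Or.inl rfl
  | fromCtr x y =>
    simp only [KDart.leftCell, KDart.rightCell, KDart.leftCorner, KDart.rightCorner] at hl hr hG
    have h := (KDart.adm_fromCtr x y).1 hadm
    obtain ⟨hx, hy⟩ := faceVertex_kidx_leftFace h
    obtain ⟨hy', hx'⟩ := faceVertex_kidx_leftFace h.symm
    obtain ⟨m1, m2, m3, m4⟩ := mem_leftFace_four h
    simp only [succ, kc_kcol]
    split_ifs with h1 h2
    · right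
      simp only [KDart.rightCell, fin3_add_two_add_two, hy]
      refine ⟨h, leftFace y x, m3, m4, hr, ?_⟩
      exact noAlt h (Or.inl hG) (leftFace_ne_leftFace_rev h) m1 m2 m3 m4 hl hr h1
    · right
      simp only [KDart.rightCell]
      exact ⟨h, leftFace y x, m3, m4, hr, h2⟩
    · left; simp only [KDart.rightCell, fin3_add_two_add_two, hx']

end Step

end Summit.CriticalPhenomena.CardyFormulaZ2.Theorems.BondTriangularCardyLine.KiteB
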